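import Summits.HodgeConjecture.HodgeConjecture.Theorems.BiquadraticSecantLiftPairing
import HarnessLib

/-!
# BiquadraticSecantLift · X2 — the `η`-translates of `π₀^* x` on `H¹(⨁_{Fin 2} A)`:
# formulas, linear independence, and their `Q_{h₂}`-pairings

Helper file for crux X2 `BiquadraticBaseChangeHyperbolic` (stmt-HodgeConjecture-22133) of
route-HodgeConjecture-BiquadraticSecantLift. `B = ⨁_{Fin 2} A`, `η = etaTwo A φ m = (φ ⊕ φ) ≫ (𝟙 + ψ_m)`,
`φ ≫ φ = -d`. For `y ∈ H¹(A)`: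
* `η^* π₀^*y = π₀^*φ^*y + m·π₁^*φ^*y`, `(η^*)² π₀^*y = -d(1+m)·π₀^*y - 2dm·π₁^*y`,
  `(η^*)³ π₀^*y = -d(1+3m)·π₀^*φ^*y - dm(3+m)·π₁^*φ^*y` (§1);
* if the `12` classes `x_b, φ^*x_b` (`b < 6`) are independent in `H¹(A)` then the `24` translates
  `(η^*)ʲ π₀^* x_b` (`j < 4`) are independent in `H¹(B)` (§2) — Deligne's "`E`-basis `x_b ⊗ 1` of
  `H¹(A ⊗ L)`" for `L = K(√m)`;
* `Q_{h₂}((η^*)ʲ π₀^*x_a, π₀^*x_b) = (c_j / 2)·L(h₂)` when `Q_k(x_a, x_b) = c₀ L(k)`, `Q_k(φ^*x_a, x_b) = c₁ L(k)` (§3),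
  with `c = (c₀, c₁, -d(1+m)c₀, -d(1+3m)c₁)`.

Nothing here is a case of the Hodge conjecture (HC is NOT proved; X2 is not proved by this file).

## References
[cite: Deligne1982HodgeCycles, §4 p. 30 and p. 34 (`A ⊗ E`), Lemma 4.6] [cite: Milne1999LefschetzClasses, §1 p. 643]
-/

-- every declaration of this problem lives in `Summit.HodgeConjecture.HodgeConjecture.…` (summit = sub-problem)
set_option linter.dupNamespace false

noncomputable section

open CategoryTheory CategoryTheory.Limits Polynomial Module
open Literature.AlgebraicTopology.SingularHomology Literature.Geometry.Kaehler
open Literature.AlgebraicGeometry.HodgeTheory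
open Literature.AlgebraicGeometry.Motives (AbelianVariety IsSmoothProjective polarizationPairingOne)
open Literature.AlgebraicGeometry.Milne1999 (sumPolarizationClass)
open Literature.AlgebraicGeometry.VanGeemen1994 (pullbackOne)
open Literature.AlgebraicGeometry.Pohlmann1968 (map_ι_map_π_self map_ι_map_π_ne)

namespace Summit.HodgeConjecture.HodgeConjecture.BiquadraticSecantLift

variable {A : AbelianVariety ℂ} {φ : A ⟶ A} {d m : ℕ} {k : complexBetti A.X 2}

/-! ## §1 The translates `(η^*)ʲ π₀^* y` -/

section Formulas

variable (A m φ)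

/-- `η^* (π₀^* y) = π₀^*(φ^*y) + m·π₁^*(φ^*y)` for the endomorphism `pullbackOne`. -/
theorem pullbackOne_etaTwo_π_zero (y : complexBetti A.X 1) :
    pullbackOne (twelvefold A) (etaTwo A φ m) (complexBetti.map (biproduct.π (fun _ : Fin 2 => A) 0).hom.hom.hom 1 y) =
      complexBetti.map (biproduct.π (fun _ : Fin 2 => A) 0).hom.hom.hom 1 (complexBetti.map φ.hom.hom.hom 1 y) +
        (m : ℂ) • complexBetti.map (biproduct.π (fun _ : Fin 2 => A) 1).hom.hom.hom 1 (complexBetti.map φ.hom.hom.hom 1 y) :=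
  map_etaTwo_map_π_zero A m φ y

/-- `η^* (π₁^* y) = π₁^*(φ^*y) + π₀^*(φ^*y)`. -/
theorem pullbackOne_etaTwo_π_one (y : complexBetti A.X 1) :
    pullbackOne (twelvefold A) (etaTwo A φ m) (complexBetti.map (biproduct.π (fun _ : Fin 2 => A) 1).hom.hom.hom 1 y) =
      complexBetti.map (biproduct.π (fun _ : Fin 2 => A) 1).hom.hom.hom 1 (complexBetti.map φ.hom.hom.hom 1 y) +
        complexBetti.map (biproduct.π (fun _ : Fin 2 => A) 0).hom.hom.hom 1 (complexBetti.map φ.hom.hom.hom 1 y) :=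
  map_etaTwo_map_π_one A m φ y

variable {A m φ}

/-- **`(η^*)² (π₀^* y) = -d(1+m)·π₀^* y - 2dm·π₁^* y`** (`φ^*φ^* = -d`). -/
theorem pullbackOne_etaTwo_sq_π_zero (hφ : φ ≫ φ = -(d • 𝟙 A)) (y : complexBetti A.X 1) :
    (pullbackOne (twelvefold A) (etaTwo A φ m) ^ 2) (complexBetti.map (biproduct.π (fun _ : Fin 2 => A) 0).hom.hom.hom 1 y) =
      (-((d : ℂ) * (1 + (m : ℂ)))) • complexBetti.map (biproduct.π (fun _ : Fin 2 => A) 0).hom.hom.hom 1 y +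
        (-(2 * (d : ℂ) * (m : ℂ))) • complexBetti.map (biproduct.π (fun _ : Fin 2 => A) 1).hom.hom.hom 1 y := by
  rw [pow_two, Module.End.mul_apply, pullbackOne_etaTwo_π_zero, map_add, map_smul, pullbackOne_etaTwo_π_zero,
    pullbackOne_etaTwo_π_one, complexBetti_map_map_one_of_comp_self hφ, map_neg, map_neg, map_smul, map_smul]
  module

/-- **`(η^*)³ (π₀^* y) = -d(1+3m)·π₀^*(φ^*y) - dm(3+m)·π₁^*(φ^*y)`.** -/
theorem pullbackOne_etaTwo_pow_three_π_zero (hφ : φ ≫ φ = -(d • 𝟙 A)) (y : complexBetti A.X 1) :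
    (pullbackOne (twelvefold A) (etaTwo A φ m) ^ 3) (complexBetti.map (biproduct.π (fun _ : Fin 2 => A) 0).hom.hom.hom 1 y) =
      (-((d : ℂ) * (1 + 3 * (m : ℂ)))) •
          complexBetti.map (biproduct.π (fun _ : Fin 2 => A) 0).hom.hom.hom 1 (complexBetti.map φ.hom.hom.hom 1 y) +
        (-((d : ℂ) * (m : ℂ) * (3 + (m : ℂ)))) •
          complexBetti.map (biproduct.π (fun _ : Fin 2 => A) 1).hom.hom.hom 1 (complexBetti.map φ.hom.hom.hom 1 y) := by
  rw [pow_succ', Module.End.mul_apply, pullbackOne_etaTwo_sq_π_zero hφ, map_add, map_smul, map_smul,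
    pullbackOne_etaTwo_π_zero, pullbackOne_etaTwo_π_one]
  module

end Formulas

/-! ## §2 Linear independence of the `24` translates -/

section Independence

/-- **The `4·6` translates `(η^*)ʲ π₀^* x_b` are `ℂ`-linearly independent** when the `2·6` classes
`(φ^*)ʲ x_b` are (project with `ι₀^*`, `ι₁^*`; `d ≠ 0`, `m ≠ 0, 1`). -/
theorem linearIndependent_translates (hφ : φ ≫ φ = -(d • 𝟙 A)) (hd : d ≠ 0) (hm0 : m ≠ 0) (hm1 : m ≠ 1)
    {x : Fin 6 → complexBetti A.X 1}
    (hli : LinearIndependent ℂ (fun p : Fin 2 × Fin 6 => (pullbackOne A φ ^ (p.1 : ℕ)) (x p.2))) :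
    LinearIndependent ℂ (fun p : Fin 4 × Fin 6 =>
      (pullbackOne (twelvefold A) (etaTwo A φ m) ^ (p.1 : ℕ))
        (complexBetti.map (biproduct.π (fun _ : Fin 2 => A) 0).hom.hom.hom 1 (x p.2))) := by
  have hdC : (d : ℂ) ≠ 0 := Nat.cast_ne_zero.2 hd
  have hmC : (m : ℂ) ≠ 0 := Nat.cast_ne_zero.2 hm0
  have hm1C : (m : ℂ) - 1 ≠ 0 := sub_ne_zero.2 (by exact_mod_cast hm1)
  set N := pullbackOne (twelvefold A) (etaTwo A φ m) with hN
  set F := pullbackOne A φ with hF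
  -- the translate formulas (`F y = φ^* y` definitionally)
  have f0 : ∀ y : complexBetti A.X 1, (N ^ ((0 : Fin 4) : ℕ)) (complexBetti.map (biproduct.π (fun _ : Fin 2 => A) 0).hom.hom.hom 1 y) =
      complexBetti.map (biproduct.π (fun _ : Fin 2 => A) 0).hom.hom.hom 1 y := fun y ↦ by
    rw [Fin.val_zero, pow_zero, Module.End.one_apply]
  have f1 : ∀ y : complexBetti A.X 1, (N ^ ((1 : Fin 4) : ℕ)) (complexBetti.map (biproduct.π (fun _ : Fin 2 => A) 0).hom.hom.hom 1 y) =
      complexBetti.map (biproduct.π (fun _ : Fin 2 => A) 0).hom.hom.hom 1 (F y) +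
        (m : ℂ) • complexBetti.map (biproduct.π (fun _ : Fin 2 => A) 1).hom.hom.hom 1 (F y) := fun y ↦ by
    rw [Fin.val_one, pow_one]; exact pullbackOne_etaTwo_π_zero A φ m y
  have f2 : ∀ y : complexBetti A.X 1, (N ^ ((2 : Fin 4) : ℕ)) (complexBetti.map (biproduct.π (fun _ : Fin 2 => A) 0).hom.hom.hom 1 y) =
      (-((d : ℂ) * (1 + (m : ℂ)))) • complexBetti.map (biproduct.π (fun _ : Fin 2 => A) 0).hom.hom.hom 1 y +
        (-(2 * (d : ℂ) * (m : ℂ))) • complexBetti.map (biproduct.π (fun _ : Fin 2 => A) 1).hom.hom.hom 1 y :=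
    fun y ↦ pullbackOne_etaTwo_sq_π_zero hφ y
  have f3 : ∀ y : complexBetti A.X 1, (N ^ ((3 : Fin 4) : ℕ)) (complexBetti.map (biproduct.π (fun _ : Fin 2 => A) 0).hom.hom.hom 1 y) =
      (-((d : ℂ) * (1 + 3 * (m : ℂ)))) • complexBetti.map (biproduct.π (fun _ : Fin 2 => A) 0).hom.hom.hom 1 (F y) +
        (-((d : ℂ) * (m : ℂ) * (3 + (m : ℂ)))) • complexBetti.map (biproduct.π (fun _ : Fin 2 => A) 1).hom.hom.hom 1 (F y) :=
    fun y ↦ pullbackOne_etaTwo_pow_three_π_zero hφ y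
  have i00 : ∀ y : complexBetti A.X 1, complexBetti.map (biproduct.ι (fun _ : Fin 2 => A) 0).hom.hom.hom 1
      (complexBetti.map (biproduct.π (fun _ : Fin 2 => A) 0).hom.hom.hom 1 y) = y :=
    fun y ↦ map_ι_map_π_self (fun _ : Fin 2 => A) 0 y
  have i11 : ∀ y : complexBetti A.X 1, complexBetti.map (biproduct.ι (fun _ : Fin 2 => A) 1).hom.hom.hom 1
      (complexBetti.map (biproduct.π (fun _ : Fin 2 => A) 1).hom.hom.hom 1 y) = y :=
    fun y ↦ map_ι_map_π_self (fun _ : Fin 2 => A) 1 y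
  have i01 : ∀ y : complexBetti A.X 1, complexBetti.map (biproduct.ι (fun _ : Fin 2 => A) 0).hom.hom.hom 1
      (complexBetti.map (biproduct.π (fun _ : Fin 2 => A) 1).hom.hom.hom 1 y) = 0 :=
    fun y ↦ map_ι_map_π_ne (fun _ : Fin 2 => A) (show (0 : Fin 2) ≠ 1 by decide) y
  have i10 : ∀ y : complexBetti A.X 1, complexBetti.map (biproduct.ι (fun _ : Fin 2 => A) 1).hom.hom.hom 1
      (complexBetti.map (biproduct.π (fun _ : Fin 2 => A) 0).hom.hom.hom 1 y) = 0 :=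
    fun y ↦ map_ι_map_π_ne (fun _ : Fin 2 => A) (show (1 : Fin 2) ≠ 0 by decide) y
  -- independence on `A`, unpacked: `Σ_b α_b x_b + β_b φ^*x_b = 0 ⟹ α = β = 0`
  rw [Fintype.linearIndependent_iff] at hli ⊢
  have hA : ∀ α β : Fin 6 → ℂ, ∑ b, (α b • x b + β b • F (x b)) = 0 → (∀ b, α b = 0) ∧ ∀ b, β b = 0 := by
    intro α β h
    have h' := hli (fun p => ![α p.2, β p.2] p.1) (by
      rw [Fintype.sum_prod_type_right, ← h]
      refine Finset.sum_congr rfl fun b _ ↦ ?_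
      rw [Fin.sum_univ_two]
      simp only [Matrix.cons_val_zero, Matrix.cons_val_one, Fin.val_zero, Fin.val_one, pow_zero,
        pow_one, Module.End.one_apply])
    exact ⟨fun b ↦ by simpa using h' (0, b), fun b ↦ by simpa using h' (1, b)⟩
  intro g hg
  rw [Fintype.sum_prod_type, Fin.sum_univ_four] at hg
  simp only [f0, f1, f2, f3] at hg
  -- project to the two summands
  have e0 := congrArg (complexBetti.map (biproduct.ι (fun _ : Fin 2 => A) 0).hom.hom.hom 1) hg
  have e1 := congrArg (complexBetti.map (biproduct.ι (fun _ : Fin 2 => A) 1).hom.hom.hom 1) hg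
  simp only [map_add, map_sum, map_smul, map_zero, i00, i01, i10, i11, smul_zero, add_zero, zero_add,
    Finset.sum_const_zero] at e0 e1
  obtain ⟨h02, h13⟩ := hA (fun b ↦ g (0, b) + (-((d : ℂ) * (1 + (m : ℂ)))) * g (2, b))
    (fun b ↦ g (1, b) + (-((d : ℂ) * (1 + 3 * (m : ℂ)))) * g (3, b)) (by
      rw [← e0, ← Finset.sum_add_distrib, ← Finset.sum_add_distrib, ← Finset.sum_add_distrib]
      exact Finset.sum_congr rfl fun b _ ↦ by module)
  obtain ⟨h2, h13'⟩ := hA (fun b ↦ (-(2 * (d : ℂ) * (m : ℂ))) * g (2, b))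
    (fun b ↦ (m : ℂ) * g (1, b) + (-((d : ℂ) * (m : ℂ) * (3 + (m : ℂ)))) * g (3, b)) (by
      rw [← e1, ← Finset.sum_add_distrib, ← Finset.sum_add_distrib]
      exact Finset.sum_congr rfl fun b _ ↦ by module)
  have g2 : ∀ b, g (2, b) = 0 := fun b ↦ by
    have h := h2 b
    simp only [mul_eq_zero, neg_eq_zero, hdC, hmC, or_false, two_ne_zero, false_or] at h
    exact h
  have g3 : ∀ b, g (3, b) = 0 := fun b ↦ by
    have ha := h13 b
    have hb := h13' b
    have h : (2 * (d : ℂ) * (m : ℂ) * ((m : ℂ) - 1)) * g (3, b) = 0 := by linear_combination hb - (m : ℂ) * ha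
    simpa [mul_eq_zero, hdC, hmC, hm1C] using h
  have g0 : ∀ b, g (0, b) = 0 := fun b ↦ by have h := h02 b; rwa [g2 b, mul_zero, add_zero] at h
  have g1 : ∀ b, g (1, b) = 0 := fun b ↦ by have h := h13 b; rwa [g3 b, mul_zero, add_zero] at h
  rintro ⟨j, b⟩
  fin_cases j
  · exact g0 b
  · exact g1 b
  · exact g2 b
  · exact g3 b

end Independence

/-! ## §3 The pairings `Q_{h₂}((η^*)ʲ π₀^* x_a, π₀^* x_b)` -/

section Pairings

/-- **`Q_{h₂}((η^*)ʲ π₀^* x_a, π₀^* x_b) = (c_j / 2) · L(h₂)`, `c = (c₀, c₁, -d(1+m)c₀, -d(1+3m)c₁)`,** when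
`Q_k(x_a, x_b) = c₀·L(k)` and `Q_k(φ^* x_a, x_b) = c₁·L(k)` (the `(0,0)` block is `½`, the cross blocks vanish). -/
theorem pairing_translate (hA : 0 < A.dim) (hφ : φ ≫ φ = -(d • 𝟙 A)) {xa xb : complexBetti A.X 1} {c₀ c₁ : ℚ}
    (h0 : polarizationPairingOne A.X k (A.dim - 1) xa xb = ((c₀ : ℚ) : ℂ) • lefschetzPow k (A.dim - 1) 2 k)
    (h1 : polarizationPairingOne A.X k (A.dim - 1) (complexBetti.map φ.hom.hom.hom 1 xa) xb =
      ((c₁ : ℚ) : ℂ) • lefschetzPow k (A.dim - 1) 2 k) (j : Fin 4) :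
    polarizationPairingOne (twelvefold A).X (sumPolarizationClass (fun _ : Fin 2 => A) ![k, (m : ℂ) • k])
        ((twelvefold A).dim - 1)
        ((pullbackOne (twelvefold A) (etaTwo A φ m) ^ (j : ℕ))
          (complexBetti.map (biproduct.π (fun _ : Fin 2 => A) 0).hom.hom.hom 1 xa))
        (complexBetti.map (biproduct.π (fun _ : Fin 2 => A) 0).hom.hom.hom 1 xb) =
      (((![c₀, c₁, -((d : ℚ) * (1 + (m : ℚ))) * c₀, -((d : ℚ) * (1 + 3 * (m : ℚ))) * c₁] j : ℚ) : ℂ) / 2) •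
        lefschetzPow (sumPolarizationClass (fun _ : Fin 2 => A) ![k, (m : ℂ) • k]) ((twelvefold A).dim - 1) 2
          (sumPolarizationClass (fun _ : Fin 2 => A) ![k, (m : ℂ) • k]) := by
  set Q₂ := polarizationPairingOne (twelvefold A).X (sumPolarizationClass (fun _ : Fin 2 => A) ![k, (m : ℂ) • k])
    ((twelvefold A).dim - 1) with hQ₂
  set P0 := (complexBetti.map (biproduct.π (fun _ : Fin 2 => A) 0).hom.hom.hom 1).hom with hP0
  set P1 := (complexBetti.map (biproduct.π (fun _ : Fin 2 => A) 1).hom.hom.hom 1).hom with hP1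
  -- the blocks on the frozen names
  have cross : ∀ u v : complexBetti A.X 1, Q₂ (P1 u) (P0 v) = 0 := fun u v ↦
    pairing_two_cross (k := k) (m := m) hA (show (1 : Fin 2) ≠ 0 by decide) u v
  have block : ∀ {u v : complexBetti A.X 1} {c : ℂ},
      polarizationPairingOne A.X k (A.dim - 1) u v = c • lefschetzPow k (A.dim - 1) 2 k →
      Q₂ (P0 u) (P0 v) = (c / 2) • lefschetzPow (sumPolarizationClass (fun _ : Fin 2 => A) ![k, (m : ℂ) • k])
        ((twelvefold A).dim - 1) 2 (sumPolarizationClass (fun _ : Fin 2 => A) ![k, (m : ℂ) • k]) :=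
    fun hc ↦ pairing_two_block_zero (m := m) hA hc
  match j with
  | 0 =>
    change Q₂ ((pullbackOne (twelvefold A) (etaTwo A φ m) ^ 0) (P0 xa)) (P0 xb) = _
    rw [pow_zero, Module.End.one_apply, block h0]
    simp only [Matrix.cons_val_zero]
  | 1 =>
    change Q₂ ((pullbackOne (twelvefold A) (etaTwo A φ m) ^ 1) (P0 xa)) (P0 xb) = _
    rw [pow_one]
    change Q₂ (pullbackOne (twelvefold A) (etaTwo A φ m)
      (complexBetti.map (biproduct.π (fun _ : Fin 2 => A) 0).hom.hom.hom 1 xa)) (P0 xb) = _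
    rw [pullbackOne_etaTwo_π_zero, map_add, map_smul, LinearMap.add_apply, LinearMap.smul_apply]
    change Q₂ (P0 (complexBetti.map φ.hom.hom.hom 1 xa)) (P0 xb) + (m : ℂ) • Q₂ (P1 (complexBetti.map φ.hom.hom.hom 1 xa)) (P0 xb) = _
    rw [cross, smul_zero, add_zero, block h1]
    simp only [Matrix.cons_val_one, Matrix.cons_val_zero]
  | 2 =>
    change Q₂ ((pullbackOne (twelvefold A) (etaTwo A φ m) ^ 2)
      (complexBetti.map (biproduct.π (fun _ : Fin 2 => A) 0).hom.hom.hom 1 xa)) (P0 xb) = _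
    rw [pullbackOne_etaTwo_sq_π_zero hφ, map_add, map_smul, map_smul, LinearMap.add_apply, LinearMap.smul_apply,
      LinearMap.smul_apply]
    change (-((d : ℂ) * (1 + (m : ℂ)))) • Q₂ (P0 xa) (P0 xb) + (-(2 * (d : ℂ) * (m : ℂ))) • Q₂ (P1 xa) (P0 xb) = _
    rw [cross, smul_zero, add_zero, block h0, smul_smul]
    congr 1
    simp only [Matrix.cons_val]
    push_cast
    ring
  | 3 =>
    change Q₂ ((pullbackOne (twelvefold A) (etaTwo A φ m) ^ 3)
      (complexBetti.map (biproduct.π (fun _ : Fin 2 => A) 0).hom.hom.hom 1 xa)) (P0 xb) = _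
    rw [pullbackOne_etaTwo_pow_three_π_zero hφ, map_add, map_smul, map_smul, LinearMap.add_apply, LinearMap.smul_apply,
      LinearMap.smul_apply]
    change (-((d : ℂ) * (1 + 3 * (m : ℂ)))) • Q₂ (P0 (complexBetti.map φ.hom.hom.hom 1 xa)) (P0 xb) +
      (-((d : ℂ) * (m : ℂ) * (3 + (m : ℂ)))) • Q₂ (P1 (complexBetti.map φ.hom.hom.hom 1 xa)) (P0 xb) = _
    rw [cross, smul_zero, add_zero, block h1, smul_smul]
    congr 1
    simp only [Matrix.cons_val]
    push_cast
    ring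

end Pairings

end Summit.HodgeConjecture.HodgeConjecture.BiquadraticSecantLift
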